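import Mathlib

/-!
# Clause 13-J/13-R, edge brick E3 (THE MODEL KERNEL'S ANTIDERIVATIVE AND ITS TAIL CONSTANT)

Route `FilamentSkeletonRss`, ∃-side clause 13 (`Clause13RNearStraightL`, stmt-NavierStokesRegularity-23612; typing-agnostic).  Companion of
`…Clause13ExteriorInduction` (E1) and `…Clause13ExteriorInductionL2` (E2), which are stated for a generic kernel `K` with a `C¹` antiderivative
`K̃`.  For the model kernel `K_q(s) = (2q − s²)(s² + q)^{-5/2}` an antiderivative is EXPLICIT:
`K̃_q(u) = (u(u² + 2q)/((u² + q)√(u² + q)) − 1)/q` (`K̃_q′ = K_q`, `K̃_q(u) → 0` as `u → +∞`), and it obeys the two elementary bounds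
`|K̃_q(u)| ≤ 1/q` (`u ≥ 0`) and `|K̃_q(u)| ≤ 1/u²` (`u > 0`); hence `∫_{(0,∞)} |K̃_q| ≤ 1/√q + 1/√q = 2/√q` (the exact value is
`2(2−φ)/√φ·q^{-1/2} ≈ 0.60 q^{-1/2}`, φ the golden ratio; not needed).  With E2 this gives, for every `C¹_c` test variation `Y` vanishing beyond an
exit point `e`, `∫_{x>e} ‖(K_q∗Y)(x)‖² ≤ (4/q)·∫‖Y′‖²` — the exterior `L²` induction in terms of the in-ball slope energy.

* `hasDerivAt_kernelAntideriv` — `K̃_q′(u) = K_q(u)`;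
* `kernelAntideriv_abs_le_inv`, `kernelAntideriv_abs_le_inv_sq` — the two bounds;
* `integral_Ioi_abs_kernelAntideriv_le` — integrability on `(0,∞)` and `∫_{(0,∞)}|K̃_q| ≤ 2/√q`.
Lane ns-filament-19175-p1 g19; `--supports stmt-NavierStokesRegularity-23612 --as helper`.
HONEST FRAMING: elementary calculus for the bookkeeping of a HYPOTHETICAL filament skeleton on the NEGATIVE side of a MODEL route; nothing here bears on
Navier–Stokes regularity or blow-up.
-/

noncomputable section

open MeasureTheory Real Set

namespace Summit.NavierStokesRegularity.NavierStokesRegularity.Theorems.MatchedKernel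
set_option linter.dupNamespace false

/-- Positivity of `u² + q`. -/
private theorem sq_add_pos {q : ℝ} (hq : 0 < q) (u : ℝ) : 0 < u ^ 2 + q := by positivity

/-- **The explicit antiderivative of the model kernel**: with `s = √(u²+q)`,
`d/du [(u(u²+2q)/((u²+q)s) − 1)/q] = (2q − u²)·((u²+q)^{5/2})⁻¹ = K_q(u)`. [folklore] -/
theorem hasDerivAt_kernelAntideriv {q : ℝ} (hq : 0 < q) (u : ℝ) :
    HasDerivAt (fun u : ℝ => (u * (u ^ 2 + 2 * q) / ((u ^ 2 + q) * Real.sqrt (u ^ 2 + q)) - 1) / q)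
      ((2 * q - u ^ 2) * ((u ^ 2 + q) ^ (5 / 2 : ℝ))⁻¹) u := by
  have hpos : 0 < u ^ 2 + q := sq_add_pos hq u
  set s : ℝ := Real.sqrt (u ^ 2 + q) with hs
  have hs0 : 0 < s := Real.sqrt_pos.2 hpos
  have hss : s * s = u ^ 2 + q := Real.mul_self_sqrt hpos.le
  have hs2 : s ^ 2 = u ^ 2 + q := by rw [sq]; exact hss
  -- derivatives of the building blocks
  have h1 : HasDerivAt (fun u : ℝ => u ^ 2 + q) (2 * u) u := by
    simpa using (hasDerivAt_pow 2 u).add_const q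
  have hsq : HasDerivAt (fun u : ℝ => Real.sqrt (u ^ 2 + q)) ((2 * u) / (2 * Real.sqrt (u ^ 2 + q))) u :=
    h1.sqrt hpos.ne'
  have hnum : HasDerivAt (fun u : ℝ => u * (u ^ 2 + 2 * q)) (1 * (u ^ 2 + 2 * q) + u * (2 * u)) u := by
    have h2 : HasDerivAt (fun u : ℝ => u ^ 2 + 2 * q) (2 * u) u := by
      simpa using (hasDerivAt_pow 2 u).add_const (2 * q)
    exact (hasDerivAt_id u).mul h2
  have hden : HasDerivAt (fun u : ℝ => (u ^ 2 + q) * Real.sqrt (u ^ 2 + q))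
      (2 * u * Real.sqrt (u ^ 2 + q) + (u ^ 2 + q) * ((2 * u) / (2 * Real.sqrt (u ^ 2 + q)))) u := h1.mul hsq
  have hden0 : (u ^ 2 + q) * Real.sqrt (u ^ 2 + q) ≠ 0 := mul_ne_zero hpos.ne' hs0.ne'
  have hquot := (hnum.div hden hden0).sub_const (1 : ℝ)
  have hall := hquot.div_const q
  refine HasDerivAt.congr_deriv hall ?_
  -- the rpow: (u²+q)^{5/2} = (u²+q)² · s
  have hrpow : (u ^ 2 + q) ^ (5 / 2 : ℝ) = (u ^ 2 + q) ^ 2 * s := by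
    rw [show (5 / 2 : ℝ) = (2 : ℝ) + (1 / 2 : ℝ) by norm_num, Real.rpow_add hpos, Real.rpow_two, hs, Real.sqrt_eq_rpow]
  rw [hrpow, ← hs]
  field_simp
  -- polynomial identity in `u, q, s` modulo `s² = u² + q`
  linear_combination (u ^ 2 * (u ^ 2 + 2 * q)) * hs2

/-- The antiderivative's building block `h(u) = u(u²+2q)/((u²+q)√(u²+q))` splits as `u/s + q·u/s³`, `s = √(u²+q)`. -/
private theorem hfun_eq {q : ℝ} (hq : 0 < q) (u : ℝ) :
    u * (u ^ 2 + 2 * q) / ((u ^ 2 + q) * Real.sqrt (u ^ 2 + q))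
      = u / Real.sqrt (u ^ 2 + q) + q * u / Real.sqrt (u ^ 2 + q) ^ 3 := by
  have hpos : 0 < u ^ 2 + q := sq_add_pos hq u
  set s : ℝ := Real.sqrt (u ^ 2 + q) with hs
  have hs0 : 0 < s := Real.sqrt_pos.2 hpos
  have hs2 : s ^ 2 = u ^ 2 + q := Real.sq_sqrt hpos.le
  have key : u / s + q * u / s ^ 3 = u * (s ^ 2 + q) / (s ^ 2 * s) := by
    field_simp
  rw [key, hs2]
  ring

/-- **Uniform bound**: for `u ≥ 0`, `0 ≤ h(u) ≤ 2`, hence `|K̃_q(u)| ≤ 1/q`. [folklore] -/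
theorem kernelAntideriv_abs_le_inv {q : ℝ} (hq : 0 < q) {u : ℝ} (hu : 0 ≤ u) :
    |(u * (u ^ 2 + 2 * q) / ((u ^ 2 + q) * Real.sqrt (u ^ 2 + q)) - 1) / q| ≤ 1 / q := by
  have hpos : 0 < u ^ 2 + q := sq_add_pos hq u
  set s : ℝ := Real.sqrt (u ^ 2 + q) with hs
  have hs0 : 0 < s := Real.sqrt_pos.2 hpos
  have hs2 : s ^ 2 = u ^ 2 + q := Real.sq_sqrt hpos.le
  have hus : u ≤ s := by
    rw [hs]
    calc u = Real.sqrt (u ^ 2) := (Real.sqrt_sq hu).symm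
      _ ≤ Real.sqrt (u ^ 2 + q) := Real.sqrt_le_sqrt (by linarith)
  -- `0 ≤ h ≤ 2`
  have hden : 0 < (u ^ 2 + q) * s := mul_pos hpos hs0
  have hh0 : 0 ≤ u * (u ^ 2 + 2 * q) / ((u ^ 2 + q) * s) :=
    div_nonneg (mul_nonneg hu (by positivity)) hden.le
  have hh2 : u * (u ^ 2 + 2 * q) / ((u ^ 2 + q) * s) ≤ 2 := by
    rw [div_le_iff₀ hden]
    -- `u(u²+2q) ≤ 2(u²+q)s` since `u ≤ s`
    have h3 : u ^ 3 ≤ u ^ 2 * s := by nlinarith [sq_nonneg u]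
    nlinarith [mul_le_mul_of_nonneg_left hus hq.le, sq_nonneg u, h3]
  rw [abs_div, abs_of_pos hq, div_le_div_iff_of_pos_right hq]
  rw [abs_le]
  constructor <;> linarith

/-- **Decay bound**: for `u > 0`, `|h(u) − 1| ≤ q/u²`, hence `|K̃_q(u)| ≤ 1/u²`. [folklore] -/
theorem kernelAntideriv_abs_le_inv_sq {q : ℝ} (hq : 0 < q) {u : ℝ} (hu : 0 < u) :
    |(u * (u ^ 2 + 2 * q) / ((u ^ 2 + q) * Real.sqrt (u ^ 2 + q)) - 1) / q| ≤ 1 / u ^ 2 := by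
  have hpos : 0 < u ^ 2 + q := sq_add_pos hq u
  rw [hfun_eq hq u]
  set s : ℝ := Real.sqrt (u ^ 2 + q) with hs
  have hs0 : 0 < s := Real.sqrt_pos.2 hpos
  have hs2 : s ^ 2 = u ^ 2 + q := Real.sq_sqrt hpos.le
  have hus : u ≤ s := by
    rw [hs]
    calc u = Real.sqrt (u ^ 2) := (Real.sqrt_sq hu.le).symm
      _ ≤ Real.sqrt (u ^ 2 + q) := Real.sqrt_le_sqrt (by linarith)
  have hu2 : 0 < u ^ 2 := by positivity
  -- lower bound: `u/s − 1 ≥ −q/(2u²) ≥ −q/u²`, and `q u/s³ ≥ 0`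
  have hA : -(q / u ^ 2) ≤ u / s - 1 := by
    -- `1 − u/s = q/(s(s+u)) ≤ q/(2u²) ≤ q/u²`
    have h1 : u / s - 1 = -(q / (s * (s + u))) := by
      field_simp
      nlinarith [hs2]
    rw [h1, neg_le_neg_iff]
    apply div_le_div_of_nonneg_left hq.le hu2
    nlinarith [hus, hu]
  have hB : 0 ≤ q * u / s ^ 3 := by positivity
  -- upper bound: `u/s ≤ 1`, `q u/s³ ≤ q u/u³ = q/u²`
  have hC : u / s ≤ 1 := (div_le_one hs0).2 hus
  have hD : q * u / s ^ 3 ≤ q / u ^ 2 := by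
    rw [div_le_div_iff₀ (by positivity) hu2]
    have : u ^ 3 ≤ s ^ 3 := by
      exact pow_le_pow_left₀ hu.le hus 3
    nlinarith [this, hq]
  rw [abs_div, abs_of_pos hq, div_le_iff₀ hq, abs_le]
  constructor
  · have : -(q / u ^ 2) ≤ u / s + q * u / s ^ 3 - 1 := by linarith
    calc -(1 / u ^ 2 * q) = -(q / u ^ 2) := by ring
      _ ≤ _ := this
  · have : u / s + q * u / s ^ 3 - 1 ≤ q / u ^ 2 := by linarith
    calc u / s + q * u / s ^ 3 - 1 ≤ q / u ^ 2 := this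
      _ = 1 / u ^ 2 * q := by ring

/-- **Tail integral of the antiderivative**: `K̃_q` is integrable on `(0, ∞)` and `∫_{(0,∞)} |K̃_q| ≤ 2/√q`
(split at `√q`: `|K̃_q| ≤ 1/q` on `(0, √q]`, `|K̃_q| ≤ u^{-2}` beyond). [folklore] -/
theorem integral_Ioi_abs_kernelAntideriv_le {q : ℝ} (hq : 0 < q) :
    IntegrableOn (fun u : ℝ => (u * (u ^ 2 + 2 * q) / ((u ^ 2 + q) * Real.sqrt (u ^ 2 + q)) - 1) / q) (Ioi 0) ∧
    ∫ u in Ioi (0 : ℝ), |(u * (u ^ 2 + 2 * q) / ((u ^ 2 + q) * Real.sqrt (u ^ 2 + q)) - 1) / q| ≤ 2 / Real.sqrt q := by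
  set F : ℝ → ℝ := fun u => (u * (u ^ 2 + 2 * q) / ((u ^ 2 + q) * Real.sqrt (u ^ 2 + q)) - 1) / q with hF
  have ha : 0 < Real.sqrt q := Real.sqrt_pos.2 hq
  have hcont : Continuous F := by
    have hd : Differentiable ℝ F := fun u => (hasDerivAt_kernelAntideriv hq u).differentiableAt
    exact hd.continuous
  -- the two pieces
  have hI1 : IntegrableOn F (Ioc 0 (Real.sqrt q)) :=
    (hcont.continuousOn.integrableOn_Icc (μ := volume)).mono_set Ioc_subset_Icc_self
  have hbound2 : ∀ u ∈ Ioi (Real.sqrt q), ‖F u‖ ≤ u ^ (-2 : ℝ) := by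
    intro u hu
    have hu0 : 0 < u := lt_trans ha hu
    rw [Real.norm_eq_abs, hF]
    have h := kernelAntideriv_abs_le_inv_sq hq hu0
    have hr : u ^ (-2 : ℝ) = 1 / u ^ 2 := by
      rw [Real.rpow_neg hu0.le, Real.rpow_two, one_div]
    rw [hr]
    exact h
  have hI2 : IntegrableOn F (Ioi (Real.sqrt q)) := by
    have hg : IntegrableOn (fun u : ℝ => u ^ (-2 : ℝ)) (Ioi (Real.sqrt q)) :=
      integrableOn_Ioi_rpow_of_lt (by norm_num) ha
    refine Integrable.mono' hg (hcont.continuousOn.aestronglyMeasurable measurableSet_Ioi) ?_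
    exact (ae_restrict_iff' measurableSet_Ioi).2 (ae_of_all _ hbound2)
  have hunion : Ioc 0 (Real.sqrt q) ∪ Ioi (Real.sqrt q) = Ioi 0 := Ioc_union_Ioi_eq_Ioi ha.le
  have hI : IntegrableOn F (Ioi 0) := by
    rw [← hunion]; exact hI1.union hI2
  refine ⟨hI, ?_⟩
  -- integral bound
  have hdisj : Disjoint (Ioc 0 (Real.sqrt q)) (Ioi (Real.sqrt q)) := Ioc_disjoint_Ioi_same
  have hsplit : ∫ u in Ioi (0 : ℝ), |F u| = (∫ u in Ioc 0 (Real.sqrt q), |F u|) + ∫ u in Ioi (Real.sqrt q), |F u| := by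
    rw [← hunion]
    exact setIntegral_union hdisj measurableSet_Ioi hI1.abs hI2.abs
  -- piece 1: `≤ (1/q)·√q`
  have h1 : ∫ u in Ioc 0 (Real.sqrt q), |F u| ≤ ∫ u in Ioc 0 (Real.sqrt q), (1 / q : ℝ) := by
    refine setIntegral_mono_on hI1.abs (by exact integrableOn_const (by simp)) measurableSet_Ioc fun u hu => ?_
    exact kernelAntideriv_abs_le_inv hq hu.1.le
  have h1' : ∫ u in Ioc 0 (Real.sqrt q), (1 / q : ℝ) = 1 / q * Real.sqrt q := by
    rw [setIntegral_const, Real.volume_real_Ioc_of_le ha.le, sub_zero, smul_eq_mul, mul_comm]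
  -- piece 2: `≤ ∫ u^{-2} = 1/√q`
  have h2 : ∫ u in Ioi (Real.sqrt q), |F u| ≤ ∫ u in Ioi (Real.sqrt q), u ^ (-2 : ℝ) := by
    refine setIntegral_mono_on hI2.abs (integrableOn_Ioi_rpow_of_lt (by norm_num) ha) measurableSet_Ioi fun u hu => ?_
    have := hbound2 u hu
    rwa [Real.norm_eq_abs] at this
  have h2' : ∫ u in Ioi (Real.sqrt q), u ^ (-2 : ℝ) = 1 / Real.sqrt q := by
    rw [integral_Ioi_rpow_of_lt (by norm_num) ha]
    rw [show (-2 : ℝ) + 1 = -1 by norm_num, Real.rpow_neg_one]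
    field_simp
  -- assemble: `(1/q)√q + 1/√q = 2/√q`
  have hsq : 1 / q * Real.sqrt q = 1 / Real.sqrt q := by
    have hqs : Real.sqrt q * Real.sqrt q = q := Real.mul_self_sqrt hq.le
    field_simp
    linarith [hqs]
  calc ∫ u in Ioi (0 : ℝ), |F u| = (∫ u in Ioc 0 (Real.sqrt q), |F u|) + ∫ u in Ioi (Real.sqrt q), |F u| := hsplit
    _ ≤ 1 / q * Real.sqrt q + 1 / Real.sqrt q := by
        have := add_le_add (h1.trans (le_of_eq h1')) (h2.trans (le_of_eq h2'))
        exact this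
    _ = 2 / Real.sqrt q := by rw [hsq]; ring

end Summit.NavierStokesRegularity.NavierStokesRegularity.Theorems.MatchedKernel

end
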